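import Summits.AnomalousDissipation.AnomalousDissipation.Theorems.SolenoidalFractalHomogenisationLagrangianStepZ7GlueEulerThetaDefs
import Summits.AnomalousDissipation.AnomalousDissipation.Theorems.SolenoidalFractalHomogenisationLagrangianStepHighLabelDecayFrameDefs
import HarnessLib

/-!
# K1L_D (stmt-AnomalousDissipation-27980): the v29 SLOT INSTANCE `Z7Glue.Xθgw` = (V_θg) ∧ the graded frozen-frame W7 family (W_θg), and the antitonicity of
# `Vmod_E_textHTX` in its extra binder (Summits-side definitions file; review lane; `--supports stmt-AnomalousDissipation-27980 --as helper`)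

TEXTS OF RECORD by tenure RULINGS D28-19 (3) / D28-19′ (a) (registry v29 PLAN, trigger (T-c); v28 stands until (T-a)∧(T-b)∧(T-c)); prover ad-sawtooth-k1loc-p1 g16;
kernel-checked in advance by the certifier (planner ad-ideate-p5 g16, `Cruxes/LagrangianRenormalisationStep/Lines/onelevel_wthg_3probe_p5.lean` (P4), c1727952a21f).
The X slot of `Z7Glue.Vmod_E_textHTX X e` (…Z7GlueEulerThetaDefs) was made GENERIC by RULING D28-3 precisely so that a new cell-scale design input threads with
zero new glue; `Z7Glue.Xθg` (the graded (V_θ) instance named by the v28 registered stub `stub_Vmod_EHTthg`) is NEVER edited — this file names the NEW instance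
* `Xθgw W M hM c Φ lo hi Λ β σ C ν₀ K := Xθg W M hM c Φ lo hi Λ β σ C ν₀ K ∧ (∀ Kb ≥ 1, ∃ CK ≥ 1, ∃ cK > 0, ∃ νh > 0, ∃ θW > 0, HighLabelDecayWthg W M hM lo hi Λ β νh Kb CK cK θW)`
  (the W-conjunct has the shape of the flat family hypothesis (H) of `Vmod_E_textHTX` with `∃ θW > 0` innermost — consumers fix finitely many `Kb`, then
  `θ₁ ≤ min θW(Kb)` inside the bracket),
* `Xθgw_mono_ν₀` (shape of `Xθg_mono_ν₀`; the W-conjunct is `ν₀`-free) — the `hX` hypothesis of `cellInputs_BIL_ofEulerX` at `X := Xθgw`,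
* `vmod_E_textHTX_anti` — `Vmod_E_textHTX X e` is ANTITONE in `X` (a stronger binder gives a weaker obligation), whence the superseded-by-WEAKER certificate of
  the planned move `stub_Vmod_EHTthg ↦ stub_Vmod_EHTthgw : Vmod_E_textHTX Xθgw (fun σ => min (σ/2) (1/2))` is `vmod_E_textHTX_anti (fun … h => h.1)`
  (`vmod_E_textHTX_Xθgw_of_Xθg` below).
The v29 registered PRODUCER `stub_W7thg` (D28-19′ (a): `∀ M hM lo hi Λ β, guards → ∀ Kb ≥ 1, ∃ CK ≥ 1, ∃ cK > 0, ∃ ν₀ > 0, ∃ θW > 0,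
HighLabelDecayWthg cubatureWord M hM lo hi Λ β ν₀ Kb CK cK θW`) is supplied by the twisted port of the W7 engine (this lineage); composition `hXw := ⟨hX, hW⟩`.
Definitions + one-line certificates only; NOT a proof of any stub, of K1L_D or of AD; rung F-D1.A0.
-/

set_option linter.dupNamespace false

noncomputable section

namespace Summit.AnomalousDissipation.AnomalousDissipation.Theorems.SolenoidalFractalHomogenisation.LagrangianStep.Z7Glue

open Literature.Analysis Literature.Analysis.FluidPDE Literature.Analysis.FunctionSpaces
open MeasureTheory Set
open scoped InnerProductSpace
open Literature.Analysis.FluidPDE.LatticeShear (LagrangianLatticeCarrier LatticeWord)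

/-- **`Xθgw` — the v29 slot instance** (RULING D28-19 (3)): the graded (V_θ) binder `Xθg` AND the graded frozen-frame W7 family
`∀ Kb ≥ 1, ∃ CK ≥ 1, ∃ cK > 0, ∃ νh > 0, ∃ θW > 0, HighLabelDecayWthg W M hM lo hi Λ β νh Kb CK cK θW`. -/
def Xθgw {k : ℕ} (W : LatticeWord k) (M : ℝ) (hM : 0 < M) (c : ℝ) (Φ : ℝ → Torus.Visc4 (Fin 3) → Torus.Visc4 (Fin 3))
    (lo hi Λ β σ C ν₀ K : ℝ) : Prop :=
  Xθg W M hM c Φ lo hi Λ β σ C ν₀ K ∧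
    (∀ Kb : ℝ, 1 ≤ Kb → ∃ CK : ℝ, 1 ≤ CK ∧ ∃ cK > (0:ℝ), ∃ νh > (0:ℝ), ∃ θW > (0:ℝ), HighLabelDecayWthg W M hM lo hi Λ β νh Kb CK cK θW)

/-- `Xθgw` is antitone in the threshold `ν₀` — the `hX` hypothesis of `cellInputs_BIL_ofEulerX` at `X := Xθgw` (the W-conjunct is `ν₀`-free). [folklore] -/
theorem Xθgw_mono_ν₀ {k : ℕ} (W : LatticeWord k) (M : ℝ) (hM : 0 < M) (c : ℝ) (Φ : ℝ → Torus.Visc4 (Fin 3) → Torus.Visc4 (Fin 3))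
    (lo hi Λ β σ C ν₀ ν₀' K : ℝ) (hle : ν₀' ≤ ν₀) (h : Xθgw W M hM c Φ lo hi Λ β σ C ν₀ K) :
    Xθgw W M hM c Φ lo hi Λ β σ C ν₀' K :=
  ⟨Xθg_mono_ν₀ W M hM c Φ lo hi Λ β σ C ν₀ ν₀' K hle h.1, h.2⟩

/-- The two conjuncts of the slot, by name (for the composition `hXw := ⟨hX, hW⟩` and its readers). [folklore] -/
theorem Xθgw_iff {k : ℕ} (W : LatticeWord k) (M : ℝ) (hM : 0 < M) (c : ℝ) (Φ : ℝ → Torus.Visc4 (Fin 3) → Torus.Visc4 (Fin 3))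
    (lo hi Λ β σ C ν₀ K : ℝ) :
    Xθgw W M hM c Φ lo hi Λ β σ C ν₀ K ↔
      Xθg W M hM c Φ lo hi Λ β σ C ν₀ K ∧
        (∀ Kb : ℝ, 1 ≤ Kb → ∃ CK : ℝ, 1 ≤ CK ∧ ∃ cK > (0:ℝ), ∃ νh > (0:ℝ), ∃ θW > (0:ℝ), HighLabelDecayWthg W M hM lo hi Λ β νh Kb CK cK θW) :=
  Iff.rfl

/-- **`Vmod_E_textHTX X e` is ANTITONE in the extra binder `X`** (RULING D28-19 (3)): a pointwise stronger `X'` gives a weaker obligation. [folklore] -/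
theorem vmod_E_textHTX_anti
    {X X' : ∀ {k : ℕ}, LatticeWord k → (M : ℝ) → 0 < M → ℝ → (ℝ → Torus.Visc4 (Fin 3) → Torus.Visc4 (Fin 3)) → ℝ → ℝ → ℝ → ℝ → ℝ → ℝ → ℝ → ℝ → Prop}
    (hXX : ∀ {k : ℕ} (W : LatticeWord k) (M : ℝ) (hM : 0 < M) (c : ℝ) (Φ : ℝ → Torus.Visc4 (Fin 3) → Torus.Visc4 (Fin 3)) (lo hi Λ β σ C ν₀ K : ℝ),
      X' W M hM c Φ lo hi Λ β σ C ν₀ K → X W M hM c Φ lo hi Λ β σ C ν₀ K)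
    {e : ℝ → ℝ} (h : Vmod_E_textHTX X e) : Vmod_E_textHTX X' e := by
  intro k W M hM c hc Φ lo hi Λ β σ C ν₀ K hlo hlo1 hhi hΛ hβ hσ hC hν₀ hν₀1 hK hV hX hH
  exact h k W M hM c hc Φ lo hi Λ β σ C ν₀ K hlo hlo1 hhi hΛ hβ hσ hC hν₀ hν₀1 hK hV (hXX W M hM c Φ lo hi Λ β σ C ν₀ K hX) hH

/-- **The superseded-by-WEAKER certificate of the planned v29 move** `stub_Vmod_EHTthg ↦ stub_Vmod_EHTthgw`: the text at `X := Xθg` implies the text at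
`X := Xθgw` (drop the W-conjunct). [folklore] -/
theorem vmod_E_textHTX_Xθgw_of_Xθg {e : ℝ → ℝ} (h : Vmod_E_textHTX Xθg e) : Vmod_E_textHTX Xθgw e :=
  vmod_E_textHTX_anti (X := Xθg) (X' := Xθgw) (fun _ _ _ _ _ _ _ _ _ _ _ _ _ h => h.1) h

end Summit.AnomalousDissipation.AnomalousDissipation.Theorems.SolenoidalFractalHomogenisation.LagrangianStep.Z7Glue

end
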